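import Summits.CriticalPhenomena.PercolationContinuityZ3.Theses.PercNonProliferation

/-!
# Sketch (crux-ideate round 2, ideator 5) — crux stmt-CriticalPhenomena-4446 `SubpolynomialBlocking`

Workfile `Cruxes/SubpolynomialBlocking/SketchIdeator5.lean`. Statements only (`sorry` in the two
open/first lemmas); the encoding of the crux is checked by `crux_iff` (`Iff.rfl`).

* `productFloor` — the TWO-SIDED CHARGING FLOOR (provable now; BK + Harris):
  `∏_{v ∈ ∂ⁱⁿΛ_{m}} (1 − P(v ↔ Λ_n inside Λ_m) · P(v ↔ ∂ⁱⁿΛ_{2n} inside Λ_{2n})) ≤ u_n`, `m = n + ⌊n/2⌋`.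
  Every open crossing of `A(n,2n)` has a first visit `v` to the mid-sphere; the initial segment is an
  inward (half-space-type) arm inside `Λ_m`, the final segment an outward bulk arm, edge-disjoint ⇒
  `P(A_v) ≤ h_in(v) g_out(v)` (van den Berg–Kesten); the events "no crossing whose first mid-sphere
  visit is `v`" are decreasing ⇒ Harris. It refines `Theorems…Subsurface.subsurfaceHarris`
  (cost per site `h_in(v)·const`) by the bulk one-arm factor `g_out(v) ≤ π(⌊n/2⌋)`.
* `floor_of_armRates` — any half-space one-arm rate `a` and bulk one-arm rate `b` at `p_c(ℤ³)` give
  `u_n ≥ exp(−C n^{2−a−b})`; reaching a POLYNOMIAL (let alone the crux's `n^{-o(1)}`) needs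
  `a + b ≥ 2`, against the numerical `0.975 + 0.48 = 1.455`: the typed ceiling of the whole
  Harris/charging class (MEMO-ideator5-r2.md §2).
-/

noncomputable section

namespace Summit.CriticalPhenomena.PercolationContinuityZ3.Cruxes.SubpolynomialBlocking.Ideate5

open MeasureTheory Filter Topology
open Literature.Probability.LatticeModels Literature.Probability.Percolation
open Summit.CriticalPhenomena.PercolationContinuityZ3.Theses

/-- The critical bond measure on `ℤ³`. -/
def μc : Measure (BondConfig (Site 3)) := bondPercolation (zdGraph 3) (criticalProbI 3)

/-- The crux's blocking event `{Λ_n ↮ ∂ⁱⁿΛ_{2n} inside Λ_{2n}}` (verbatim). -/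
def blockEv (n : ℕ) : Set (BondConfig (Site 3)) :=
  {ω | ¬ ∃ x ∈ box 3 n, ∃ y ∈ innerBoundary (zdGraph 3) (box 3 (2 * n)),
    ω ∈ openConnIn (↑(box 3 (2 * n)) : Set (Site 3)) x y}

/-- Encoding check: the crux is `∀ s > 0, ∀ᶠ n, n^{-s} ≤ μc(blockEv n)`. -/
theorem crux_iff :
    PercNonProliferation.SubpolynomialBlocking ↔
      ∀ s : ℝ, 0 < s → ∀ᶠ n : ℕ in atTop, (n : ℝ) ^ (-s) ≤ μc.real (blockEv n) :=
  Iff.rfl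

/-- Mid-sphere radius `m = n + ⌊n/2⌋`. -/
def midR (n : ℕ) : ℕ := n + n / 2

/-- The mid-sphere `∂ⁱⁿΛ_m`. -/
def midSphere (n : ℕ) : Finset (Site 3) := innerBoundary (zdGraph 3) (box 3 (midR n))

/-- Inward arm: `v` is joined to the inner box `Λ_n` by an open path inside `Λ_m`
(for `v` on a face of `∂ⁱⁿΛ_m` this is a half-space-type arm of length `⌊n/2⌋`). -/
def inArm (v : Site 3) (n : ℕ) : Set (BondConfig (Site 3)) :=
  {ω | ∃ x ∈ box 3 n, ω ∈ openConnIn (↑(box 3 (midR n)) : Set (Site 3)) v x}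

/-- Outward arm: `v` is joined to `∂ⁱⁿΛ_{2n}` by an open path inside `Λ_{2n}` (a bulk arm of
sup-length `≥ n - ⌊n/2⌋`; re-entries into `Λ_m` allowed). -/
def outArm (v : Site 3) (n : ℕ) : Set (BondConfig (Site 3)) :=
  {ω | ∃ y ∈ innerBoundary (zdGraph 3) (box 3 (2 * n)),
    ω ∈ openConnIn (↑(box 3 (2 * n)) : Set (Site 3)) v y}

/-- **FIRST LEMMA (product floor; provable now).** For every `n ≥ 1`,
`∏_{v ∈ ∂ⁱⁿΛ_m} (1 − μc(inArm v n) · μc(outArm v n)) ≤ u_n`.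
Proof sketch: `Cross ⊆ ⋃_v A_v`, `A_v` = "some open crossing path has its FIRST visit to `∂ⁱⁿΛ_m`
at `v`" (increasing); `A_v ⊆ inArm v n □ outArm v n` (initial and final segments of a self-avoiding
path are edge-disjoint; before its first visit to the sphere the path stays in `Λ_m`), so
`μc(A_v) ≤ μc(inArm)·μc(outArm)` by `bk_finitary_list`; then
`u_n = μc(⋂_v A_vᶜ) ≥ ∏_v μc(A_vᶜ)` by Harris (`harris_fkg_lower`) for the decreasing `A_vᶜ`. -/
theorem productFloor (n : ℕ) (hn : 1 ≤ n) :
    ∏ v ∈ midSphere n, (1 - μc.real (inArm v n) * μc.real (outArm v n)) ≤ μc.real (blockEv n) := by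
  sorry

/-- Half-space one-arm RATE at `p_c(ℤ³)` (quantitative Barsky–Grimmett–Newman; OPEN):
`P_{p_c}(0 ↔ sup-distance n inside the half-space {x₀ ≥ 0}) ≤ C n^{-a}`. -/
def HalfSpaceArmRate (a : ℝ) : Prop :=
  ∃ C : ℝ, ∀ n : ℕ, 1 ≤ n →
    μc.real {ω | ∃ y : Site 3, (y ∉ box 3 (n - 1)) ∧
      ω ∈ openConnIn {z : Site 3 | 0 ≤ z 0} 0 y} ≤ C * (n : ℝ) ^ (-a)

/-- Bulk one-arm RATE at `p_c(ℤ³)` (quantitative `θ(p_c) = 0`; OPEN and summit-strength):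
`P_{p_c}(0 ↔ ∂ⁱⁿΛ_n) ≤ C n^{-b}`. -/
def BulkArmRate (b : ℝ) : Prop :=
  ∃ C : ℝ, ∀ n : ℕ, 1 ≤ n →
    μc.real {ω | ∃ y ∈ innerBoundary (zdGraph 3) (box 3 n),
      ω ∈ openConnIn (Set.univ : Set (Site 3)) 0 y} ≤ C * (n : ℝ) ^ (-b)

/-- **Ceiling of the Harris/charging class (provable from `productFloor`).** Two arm rates give the
stretched-exponential floor `exp(−C n^{2−a−b}) ≤ u_n`; it is polynomial iff `a + b ≥ 2`. With the
numerical `d = 3` exponents `a = x_s ≈ 0.975`, `b = x_b ≈ 0.48` the best floor of this type is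
`exp(−C n^{0.545})` — this class cannot reach `SubpolynomialBlocking` (exponent `0`). -/
theorem floor_of_armRates {a b : ℝ} (ha : HalfSpaceArmRate a) (hb : BulkArmRate b) :
    ∃ C : ℝ, 0 < C ∧ ∀ᶠ n : ℕ in atTop,
      Real.exp (-(C * (n : ℝ) ^ (2 - a - b))) ≤ μc.real (blockEv n) := by
  sorry

end Summit.CriticalPhenomena.PercolationContinuityZ3.Cruxes.SubpolynomialBlocking.Ideate5
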